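import Summits.AnomalousDissipation.AnomalousDissipation.Theorems.SolenoidalFractalHomogenisationLagrangianStepCellEnergyTDualLeak
import Literature.Analysis.FluidPDE.PassiveVectorTensorDuality
import HarnessLib

/-!
# K1L_D `stub_cellEnergyT` by DUALITY, part 3/3: `DualityBound` from D1, `SlowModeBound`, and the UNCONDITIONAL uniform clause (F)

Part 3: `slowModeBound_core : DualityBound → SlowModeBound`, `dualityBound_core : PairingConst → DualityBound`, the net conditional theorems
`cellEnergyT_of_pairingConst` / `cellEnergyT_W_of_pairingConst`, and — NEW in this landing — the discharge of D1 from the tree: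
`pairingConst : PairingConst` (ad-lit g25's `IsWeakTensorPassiveVectorOn.exists_ae_integral_inner_reversed_eq_const`, p640160; adapter verified
on the farm by ad-lit, STATUS 14:18:10Z), hence `dualityBound`, `slowModeBound`, `uniformSlowLeak`, **`cellEnergyT_uniform`** (the v21
`stub_cellEnergyT` text: `∃ C ≥ 0, ∃ ν₀ > 0, ∃ K > 0, CellEnergyClausesNoE …` for EVERY word, pre-stretch, gain constant and window) and
the registry-v2 text (`CellEnergyClausesWNoE`) a fortiori as `cellEnergyT_W_of_pairingConst pairingConst` (not restated: it is the tree's `stub_cellEnergyT`, p640158) — all sorry-free and hypothesis-free.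

## Mathematics (p4 g10's module docstring of the port, verbatim)

# PORT-READY pre-image of the Theorems file closing K1L_D `stub_cellEnergyT` (v21 text) — from D1 `PairingConst` alone

Crux workfile (planner `ad-ideate-p4` g10, finding F-p4g10-1, lens «control»): this is `DualLeakageSketch.lean` v5 re-cut in the
THEOREMS shape the lead prover will land — namespace `…Theorems.SolenoidalFractalHomogenisation.LagrangianStep.CellEnergyT`, imports
the landed S-items (`…SectorCount` p638936, `…CarrierFastContent` p639358, `…MeanConservation` p638532) and ad-lit's
`PassiveVectorTensorWeakContinuity` (p638640) and cites them BY NAME, carries NO duplicate of a tree declaration, and has exactly ONE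
hypothesis left: D1 `PairingConst` (the duality pairing `s ↦ ⟨u s, ψ (t₀ − s)⟩` of a weak solution and an adjoint weak solution is
a.e. constant; ad-lit g25 is landing it in `Literature/Analysis/FluidPDE/PassiveVectorTensorDuality.lean`).  Zero `sorry`.

Net theorems: `cellEnergyT_of_pairingConst (h1 : PairingConst) : <v21 stub_cellEnergyT statement verbatim>` (uniform clauses
`CellEnergyClausesNoE`, `C = 36k²Λ²/(π⁴lo²c)`, `ν₀ = 1`, `K = 2`) and, a fortiori (`cellEnergyClausesWNoE_of_noE`, `exp ≥ 1`),
`cellEnergyT_W_of_pairingConst (h1 : PairingConst) : <K1L_D registry-v2 stub_cellEnergyT statement verbatim>` (window-local clauses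
`CellEnergyClausesWNoE`, tenure D24-5) — use whichever text is registered when D1 lands.

TO CLOSE THE STUB once D1 has landed as a theorem `T_D1` (any binder order; note `revCarrier b t₀ = fun r x => -(b (t₀ - r) x)` is `rfl`):
copy this file to `Theorems/SolenoidalFractalHomogenisationLagrangianStepCellEnergyT.lean`, add at the end

  `theorem pairingConst : PairingConst := fun T 𝔹 lo hi hN hlo b hb F u hF2 hFdiv hu t₀ ht₀ φ ψ hφ2 hφdiv hbrev hψ => T_D1 …`
  `end CellEnergyT`
  `theorem stub_cellEnergyT : <registered text> := CellEnergyT.cellEnergyT_W_of_pairingConst CellEnergyT.pairingConst`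
  (or `CellEnergyT.cellEnergyT_of_pairingConst …` if the uniform v21 text is the registered one)

(the last one in namespace `…LagrangianStep`, by name + signature as p639096 did for `stub_gainPackageW0`), and propose
`--supports stmt-AnomalousDissipation-27980`.  Mathematics: see the module docstring of `DualLeakageSketch.lean` (same directory).

Provenance: the TEXT of every declaration below is planner `ad-ideate-p4` g10's PORT-READY crux workfile
`Cruxes/LagrangianRenormalisationStep/CellEnergyTPort.lean` v2 (commit f414c08b2b27, sha16 2d92a09157a6ab13; finding F-p4g10-1, lens «control»;
`lean check` rc 0 / 0 sorry), split VERBATIM into three Theorems files of ≤ 400 lines (`…CellEnergyTDualDefs` → `…CellEnergyTDualLeak` →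
`…CellEnergyTDual`) by prover seat `ad-k3l-bookkeeping-p1` g4 (cell STATUS 2026-08-28T14:13:02Z O4 / 14:28:06Z), with the one hypothesis D1
`PairingConst` DISCHARGED in the last file from ad-lit g25's `Literature.Analysis.FluidPDE.PassiveVectorTensorDuality` (p640160).  The registered
stub `stub_cellEnergyT` of K1L_D (stmt-AnomalousDissipation-27980) is ALREADY CLOSED by name by the lead's primal proof (p640158, `cellEnergyT_W`);
this chain is the independent DUAL proof, giving the STRONGER uniform-in-`T` clause (F) (`CellEnergyClausesNoE`, the v21 text) and (F_T) a fortiori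
(`--supports stmt-AnomalousDissipation-27980 --as helper`; no registered stub name is redeclared).  Infrastructure for route-1's rung leaf F-D1.A0
(a frontier FORMAL rung); NOT a proof of the crux, of Onsager's conjecture or of anomalous dissipation.
-/

set_option linter.dupNamespace false

noncomputable section

namespace Summit.AnomalousDissipation.AnomalousDissipation.Theorems.SolenoidalFractalHomogenisation.LagrangianStep.CellEnergyT

open Literature.Analysis Literature.Analysis.FluidPDE Literature.Analysis.FunctionSpaces
open Literature.Analysis.FluidPDE.LatticeShear
open MeasureTheory Set Filter Function UnitAddTorus
open scoped ENNReal NNReal InnerProductSpace Topology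
open Summit.AnomalousDissipation.AnomalousDissipation.Theorems.SolenoidalFractalHomogenisation.RealisedQuasiStaticCellLaw

/-- **`SlowModeBound` from D1–D3 and `CarrierFastContent` (PROVED conditional).**  Per transversal test vector `z`
(`ℓ · z = 0`): Lions adjoint solution `ψ` from `Re(e_ℓ • z)` (`exists_adjoint`), sector support of `ψ̂(r)`
(`ae_mFourierCoeff_eq_zero_off_sector` along the grid-periodic reversed carrier), fast content of `ψ(r)`
(`CarrierFastContent`), Parseval pairing with a Young parameter (`abs_integral_inner_le_young_sector`), `DualityBound`;
then `sq_le_mul_of_young`, the tests `z = q_jℂ` and `I • q_jℂ` (`transVec`), transversality of `û(t₀)(ℓ)`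
(`IsWeaklyDivFree.sum_mul_mFourierCoeff_eq_zero`) and `Σ_j ‖q_j‖² = 2`. [this sketch] -/
theorem slowModeBound_core (hDual : DualityBound) : SlowModeBound := by
  intro k W M hM lo hi lam hlo hlam ν hν n hn 𝔸 hA F hF hF0 T u hu ℓ hℓ hℓn
  rcases le_or_gt T 0 with hT | hT
  · have h0 : volume.restrict (Ioo (0:ℝ) T) = 0 := by rw [Ioo_eq_empty (not_lt.2 hT), Measure.restrict_empty]
    rw [h0]; simp
  have hn' : (0:ℝ) < n := by exact_mod_cast hn
  have hlam0 : 0 < lam := one_pos.trans_le hlam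
  have hN : Torus.NearIso ((1 / (n:ℝ) ^ 2) • 𝔸) ((1 / (n:ℝ) ^ 2) * (ν * (lo / lam))) ((1 / (n:ℝ) ^ 2) * (ν * (hi * lam))) :=
    hA.smul (by positivity)
  have hlo' : 0 < (1 / (n:ℝ) ^ 2) * (ν * (lo / lam)) := by positivity
  have hNt := (Torus.nearIso_majorTranspose_iff _ _ _).2 hN
  have hbT : MemLp (FunctionSpaces.Torus.stLift (cellField W M hM ν hν n)) ∞
      (volume.restrict (Ioo 0 T ×ˢ (univ : Set (EuclideanSpace ℝ (Fin 3))))) := memLp_top_stLift_cell _ n T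
  have hF2 : MemLp F 2 volume := memLp_two_of_memSobolev_one_complexify hF.1
  have hFi : Integrable F volume := hF2.integrable one_le_two
  have hFℓ : ∀ k', k' = ℓ ∨ k' = -ℓ → mFourierCoeff (FunctionSpaces.EuclideanSpace.complexify ∘ F) k' = 0 := by
    intro k' hk'
    have hk'n : ‖Torus.latticeVec k'‖ < (n:ℝ) / 2 := by
      rcases hk' with rfl | rfl
      · linarith
      · rw [Torus.latticeVec_neg, norm_neg]; linarith
    ext i
    rw [PiLp.zero_apply, ← modeCoeff_eq hFi]
    exact hF0 k' hk'n i
  have hℓi : ∀ i, 2 * |(ℓ i : ℝ)| ≤ n := fun i => by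
    have := abs_coord_le_norm_latticeVec ℓ i; linarith
  set P := pairSectorEnergy n ℓ F with hP_def
  have hP0 : 0 ≤ P := pairSectorEnergy_nonneg _ _ _
  set D₀ : ℝ := 9 * (k:ℝ) ^ 2 * lam ^ 2 * ‖Torus.latticeVec ℓ‖ ^ 2 / (Real.pi ^ 4 * (n:ℝ) ^ 2 * ν ^ 2 * lo ^ 2)
    with hD₀_def
  have hD₀0 : 0 ≤ D₀ := by positivity
  have hconst : ∀ E : ℝ, (3 * ((k:ℝ) / (2 * Real.pi * n)) * (2 * Real.pi * ‖Torus.latticeVec ℓ‖)) ^ 2 * E /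
      (4 * Real.pi ^ 2 * ((1 / (n:ℝ) ^ 2) * (ν * (lo / lam))) * ((n:ℝ) ^ 2 / 4)) ^ 2 = D₀ * E := by
    intro E; rw [hD₀_def]; field_simp; ring
  -- KEY: the duality estimate for one transversal test vector `z`
  have key : ∀ z : EuclideanSpace ℂ (Fin 3), (∑ j, (ℓ j : ℂ) * z j = 0) →
      ∀ᵐ t₀ ∂(volume.restrict (Ioo 0 T)),
        (∫ x, ⟪u t₀ x, FunctionSpaces.Torus.realTrigPoly {ℓ} (fun _ => z) x⟫_ℝ) ^ 2 ≤ P * (D₀ * (‖z‖ ^ 2 / 2)) := by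
    intro z hz
    have hφ2 : MemLp (FunctionSpaces.Torus.realTrigPoly {ℓ} (fun _ => z)) 2 volume :=
      FunctionSpaces.Torus.memLp_realTrigPoly _ _ _
    have hφdiv : FunctionSpaces.Torus.IsWeaklyDivFree (FunctionSpaces.Torus.realTrigPoly {ℓ} (fun _ => z)) :=
      (FunctionSpaces.Torus.isDivFree_realTrigPoly_singleton hz).isWeaklyDivFree_holds
        (FunctionSpaces.Torus.isSmooth_realTrigPoly _ _)
    have hφsupp : ∀ k', k' ≠ ℓ → k' ≠ -ℓ →
        mFourierCoeff (FunctionSpaces.EuclideanSpace.complexify ∘ FunctionSpaces.Torus.realTrigPoly {ℓ} (fun _ => z)) k' = 0 := by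
      intro k' h1' h2'
      rw [FunctionSpaces.Torus.mFourierCoeff_realTrigPoly_singleton]
      simp [h1', h2']
    have hφsupp' : ∀ k', mFourierCoeff (FunctionSpaces.EuclideanSpace.complexify ∘
        FunctionSpaces.Torus.realTrigPoly {ℓ} (fun _ => z)) k' ≠ 0 →
        (∀ i, (n:ℤ) ∣ k' i - ℓ i) ∨ (∀ i, (n:ℤ) ∣ k' i + ℓ i) := by
      intro k' hk'
      by_cases h1' : k' = ℓ
      · left; intro i; rw [h1', sub_self]; exact dvd_zero _
      by_cases h2' : k' = -ℓ
      · right; intro i; rw [h2', Pi.neg_apply, neg_add_cancel]; exact dvd_zero _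
      exact absurd (hφsupp k' h1' h2') hk'
    have hφE : ∫ x, ‖FunctionSpaces.Torus.realTrigPoly {ℓ} (fun _ => z) x‖ ^ 2 = ‖z‖ ^ 2 / 2 :=
      integral_norm_sq_realTrigPoly_singleton hℓ z
    filter_upwards [hDual T _ _ _ hN hlo' _ hbT F u hF2 hF.2.2 hu _ hφ2 hφdiv,
      ae_restrict_mem measurableSet_Ioo] with t₀ ht₀ ht₀mem
    obtain ⟨ψ, hψ⟩ := exists_adjoint W M hM hlo hlam0 hν hn hA hu ⟨ht₀mem.1, ht₀mem.2.le⟩ hφ2 hφdiv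
    have hbrev := memLp_top_stLift_revCarrier_cellField W M hM hν n t₀ t₀
    have hsect := hψ.ae_mFourierCoeff_eq_zero_off_sector hn ℓ hNt hlo' hbrev
      (fun j r x => revCarrier_cellField_add_grid W M hM hν hn j t₀ r x) hφ2 hφsupp'
    have hfast := ae_complement_pair_energy_le k n hn _ t₀ hbrev (fun s x => norm_revCarrier_cellField_le W M hM hν hn t₀ s x)
      (fun j s x => revCarrier_cellField_add_grid W M hM hν hn j t₀ s x) _ _ _ hNt hlo' ℓ hℓ hℓi _ hφ2 hφdiv hφsupp ψ hψ
    have hY : ∀ α : ℝ, 0 < α →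
        |∫ x, ⟪u t₀ x, FunctionSpaces.Torus.realTrigPoly {ℓ} (fun _ => z) x⟫_ℝ| ≤
          α / 2 * P + D₀ * (‖z‖ ^ 2 / 2) / (2 * α) := by
      intro α hα
      refine ht₀ ψ hbrev hψ _ ?_
      filter_upwards [hsect, hfast, hψ.ae_memLp_two] with r hr_sect hr_fast hr2
      refine abs_integral_inner_le_young_sector hℓ hF2 hr2 hFℓ hr_sect ?_ hα
      rw [hconst, hφE] at hr_fast
      exact hr_fast
    exact sq_le_mul_of_young hP0 (by positivity) hY
  -- combine the tests `q_jℂ` and `I • q_jℂ`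
  have hall : ∀ᵐ t₀ ∂(volume.restrict (Ioo 0 T)), ∀ j : Fin 3,
      (∫ x, ⟪u t₀ x, FunctionSpaces.Torus.realTrigPoly {ℓ}
          (fun _ => FunctionSpaces.EuclideanSpace.complexify (transVec ℓ j)) x⟫_ℝ) ^ 2
          ≤ P * (D₀ * (‖FunctionSpaces.EuclideanSpace.complexify (transVec ℓ j)‖ ^ 2 / 2)) ∧
      (∫ x, ⟪u t₀ x, FunctionSpaces.Torus.realTrigPoly {ℓ}
          (fun _ => Complex.I • FunctionSpaces.EuclideanSpace.complexify (transVec ℓ j)) x⟫_ℝ) ^ 2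
          ≤ P * (D₀ * (‖Complex.I • FunctionSpaces.EuclideanSpace.complexify (transVec ℓ j)‖ ^ 2 / 2)) := by
    refine ae_all_iff.2 fun j => ?_
    filter_upwards [key _ (sum_mul_complexify_transVec hℓ j),
      key _ (sum_mul_I_smul (sum_mul_complexify_transVec hℓ j))] with t₀ h1' h2'
    exact ⟨h1', h2'⟩
  filter_upwards [hall, hu.ae_memLp_two, hu.ae_isWeaklyDivFree] with t₀ ht hut2 hutdiv
  have huti : Integrable (u t₀) volume := hut2.integrable one_le_two
  have hvtr : ∑ i, (ℓ i : ℂ) * mFourierCoeff (FunctionSpaces.EuclideanSpace.complexify ∘ u t₀) ℓ i = 0 :=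
    hutdiv.sum_mul_mFourierCoeff_eq_zero hut2 ℓ
  have hj : ∀ j : Fin 3, ‖mFourierCoeff (FunctionSpaces.EuclideanSpace.complexify ∘ u t₀) ℓ j‖ ^ 2 ≤
      P * D₀ * ‖transVec ℓ j‖ ^ 2 := by
    intro j
    obtain ⟨hj1, hj2⟩ := ht j
    rw [FunctionSpaces.Torus.integral_inner_realTrigPoly_singleton huti] at hj1 hj2
    rw [inner_smul_right, norm_smul, Complex.norm_I, one_mul] at hj2
    rw [FunctionSpaces.EuclideanSpace.norm_complexify, inner_complexify_transVec hℓ hvtr j] at hj1 hj2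
    have e := re_sq_add_re_I_mul_sq (starRingEnd ℂ (mFourierCoeff (FunctionSpaces.EuclideanSpace.complexify ∘ u t₀) ℓ j))
    rw [RCLike.norm_conj] at e
    linarith
  have hse : sectorEnergy ℓ (u t₀) = ∑ j, ‖mFourierCoeff (FunctionSpaces.EuclideanSpace.complexify ∘ u t₀) ℓ j‖ ^ 2 := by
    rw [sectorEnergy_eq huti, EuclideanSpace.norm_sq_eq]
  rw [hse]
  calc ∑ j, ‖mFourierCoeff (FunctionSpaces.EuclideanSpace.complexify ∘ u t₀) ℓ j‖ ^ 2
      ≤ ∑ j, P * D₀ * ‖transVec ℓ j‖ ^ 2 := Finset.sum_le_sum fun j _ => hj j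
    _ = P * D₀ * ∑ j, ‖transVec ℓ j‖ ^ 2 := by rw [Finset.mul_sum]
    _ = 18 * (k:ℝ) ^ 2 * lam ^ 2 * ‖Torus.latticeVec ℓ‖ ^ 2 / (Real.pi ^ 4 * (n:ℝ) ^ 2 * ν ^ 2 * lo ^ 2) * P := by
        rw [sum_norm_sq_transVec hℓ, hD₀_def]; ring

/-- **`DualityBound` from D1** (D2 = `forall_eps_ae_integral_norm_sq_sub_le_of_nearIso`, D3 = `exists_continuousOn_integral_inner`, both p638640). -/
theorem dualityBound_core (h1 : PairingConst) : DualityBound := by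
  intro T 𝔹 lo hi hN hlo b hb F u hF2 hFdiv hu φ hφ2 hφdiv
  obtain ⟨G, hGc', -, hGae⟩ := hu.exists_continuousOn_integral_inner hF2 hφ2 hφdiv
  have hGc : ContinuousOn G (Ioo 0 T) := hGc'.mono Ioo_subset_Icc_self
  have hEF0 : 0 ≤ ∫ x, ‖F x‖ ^ 2 := integral_nonneg fun _ => by positivity
  have hEφ0 : 0 ≤ ∫ x, ‖φ x‖ ^ 2 := integral_nonneg fun _ => by positivity
  -- energy bound and slice `L²` membership for `u`
  have hEu : ∀ᵐ s ∂(volume.restrict (Ioo 0 T)), ∫ x, ‖u s x‖ ^ 2 ≤ ∫ x, ‖F x‖ ^ 2 := by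
    filter_upwards [hu.ae_energy_ineq hN hlo hF2 hFdiv hb] with s hs
    exact (ENNReal.ofReal_le_ofReal_iff hEF0).1 (le_trans le_self_add hs)
  have hu2 := hu.ae_memLp_two
  filter_upwards [hGae, ae_restrict_mem measurableSet_Ioo] with t₀ hG₀ ht₀
  intro ψ hbrev hψ B hB
  have hN' : Torus.NearIso (Torus.majorTranspose 𝔹) lo hi := (Torus.nearIso_majorTranspose_iff 𝔹 lo hi).2 hN
  obtain ⟨c, hc⟩ := h1 T 𝔹 lo hi hN hlo b hb F u hF2 hFdiv hu t₀ ⟨ht₀.1, ht₀.2.le⟩ φ ψ hφ2 hφdiv hbrev hψ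
  have hEψ : ∀ᵐ r ∂(volume.restrict (Ioo 0 t₀)), ∫ x, ‖ψ r x‖ ^ 2 ≤ ∫ x, ‖φ x‖ ^ 2 := by
    filter_upwards [hψ.ae_energy_ineq hN' hlo hφ2 hφdiv hbrev] with r hr
    exact (ENNReal.ofReal_le_ofReal_iff hEφ0).1 (le_trans le_self_add hr)
  have hψ2 := hψ.ae_memLp_two
  have hsub : Ioo 0 t₀ ⊆ Ioo 0 T := Ioo_subset_Ioo_right ht₀.2.le
  -- ### Step A: `|c| ≤ B` (look near `s = 0`)
  have hA : |c| ≤ B := by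
    refine le_of_forall_pos_le_add fun κ hκ => ?_
    obtain ⟨δ, hδ, hδu⟩ := hu.forall_eps_ae_integral_norm_sq_sub_le_of_nearIso hN hlo hF2 hFdiv hb
      (κ * (κ / ((∫ x, ‖φ x‖ ^ 2) + 1))) (by positivity)
    have hall : ∀ᵐ s ∂(volume.restrict (Ioo 0 t₀)),
        (∫ x, ⟪u s x, ψ (t₀ - s) x⟫_ℝ = c) ∧
        (s < δ → ∫ x, ‖u s x - F x‖ ^ 2 ≤ κ * (κ / ((∫ x, ‖φ x‖ ^ 2) + 1))) ∧
        (∫ x, ‖ψ (t₀ - s) x‖ ^ 2 ≤ ∫ x, ‖φ x‖ ^ 2) ∧ MemLp (ψ (t₀ - s)) 2 volume ∧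
        |∫ x, ⟪F x, ψ (t₀ - s) x⟫_ℝ| ≤ B ∧ MemLp (u s) 2 volume := by
      filter_upwards [hc, ae_restrict_of_ae_restrict_of_subset hsub hδu, ae_restrict_Ioo_reflect hEψ,
        ae_restrict_Ioo_reflect hψ2, ae_restrict_Ioo_reflect hB, ae_restrict_of_ae_restrict_of_subset hsub hu2]
        with s h1' h2' h3' h4' h5' h6'
      exact ⟨h1', h2', h3', h4', h5', h6'⟩
    have hδ'0 : 0 < min δ t₀ := lt_min hδ ht₀.1
    have hsub' : Ioo 0 (min δ t₀) ⊆ Ioo 0 t₀ := Ioo_subset_Ioo_right (min_le_right _ _)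
    obtain ⟨s, hsI, hcs, hδs, hEs, hψs, hBs, hus⟩ :=
      exists_of_ae_Ioo hδ'0 (ae_restrict_of_ae_restrict_of_subset hsub' hall)
    have hsδ : s < δ := lt_of_lt_of_le hsI.2 (min_le_left _ _)
    have hf2 : MemLp (fun x => u s x - F x) 2 volume := hus.sub hF2
    have hsplit : ∫ x, ⟪u s x, ψ (t₀ - s) x⟫_ℝ =
        (∫ x, ⟪F x, ψ (t₀ - s) x⟫_ℝ) + ∫ x, ⟪u s x - F x, ψ (t₀ - s) x⟫_ℝ := by
      rw [← integral_add (integrable_inner₂ hF2 hψs) (integrable_inner₂ hf2 hψs)]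
      refine integral_congr_ae (ae_of_all _ fun x => ?_)
      show ⟪u s x, ψ (t₀ - s) x⟫_ℝ = ⟪F x, ψ (t₀ - s) x⟫_ℝ + ⟪u s x - F x, ψ (t₀ - s) x⟫_ℝ
      rw [inner_sub_left]; ring
    have hsmall := abs_integral_inner_le_of_small hf2 hψs hκ hEφ0 (hδs hsδ) hEs
    calc |c| = |(∫ x, ⟪F x, ψ (t₀ - s) x⟫_ℝ) + ∫ x, ⟪u s x - F x, ψ (t₀ - s) x⟫_ℝ| := by rw [← hsplit, hcs]
      _ ≤ |∫ x, ⟪F x, ψ (t₀ - s) x⟫_ℝ| + |∫ x, ⟪u s x - F x, ψ (t₀ - s) x⟫_ℝ| := abs_add_le _ _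
      _ ≤ B + κ := add_le_add hBs hsmall
  -- ### Step B: `G t₀ = c` (look near `s = t₀`)
  have hB' : G t₀ = c := by
    have key : ∀ κ > (0:ℝ), |G t₀ - c| ≤ 2 * κ := by
      intro κ hκ
      obtain ⟨ρ, hρ, hρG⟩ := Metric.continuousWithinAt_iff.1 (hGc t₀ ht₀) κ hκ
      obtain ⟨δ₂, hδ₂, hδψ⟩ := hψ.forall_eps_ae_integral_norm_sq_sub_le_of_nearIso hN' hlo hφ2 hφdiv hbrev
        (κ * (κ / ((∫ x, ‖F x‖ ^ 2) + 1))) (by positivity)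
      have hall : ∀ᵐ s ∂(volume.restrict (Ioo 0 t₀)),
          (∫ x, ⟪u s x, ψ (t₀ - s) x⟫_ℝ = c) ∧
          (t₀ - s < δ₂ → ∫ x, ‖ψ (t₀ - s) x - φ x‖ ^ 2 ≤ κ * (κ / ((∫ x, ‖F x‖ ^ 2) + 1))) ∧
          (∫ x, ‖u s x‖ ^ 2 ≤ ∫ x, ‖F x‖ ^ 2) ∧ MemLp (u s) 2 volume ∧ (∫ x, ⟪u s x, φ x⟫_ℝ = G s) ∧
          MemLp (ψ (t₀ - s)) 2 volume := by
        filter_upwards [hc, ae_restrict_Ioo_reflect hδψ, ae_restrict_of_ae_restrict_of_subset hsub hEu,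
          ae_restrict_of_ae_restrict_of_subset hsub hu2, ae_restrict_of_ae_restrict_of_subset hsub hGae,
          ae_restrict_Ioo_reflect hψ2] with s h1' h2' h3' h4' h5' h6'
        exact ⟨h1', h2', h3', h4', h5', h6'⟩
      have hm1 : min (min δ₂ ρ) t₀ ≤ t₀ := min_le_right _ _
      have hm2 : min (min δ₂ ρ) t₀ ≤ δ₂ := (min_le_left _ _).trans (min_le_left _ _)
      have hm3 : min (min δ₂ ρ) t₀ ≤ ρ := (min_le_left _ _).trans (min_le_right _ _)
      have hδ₃0 : 0 < min (min δ₂ ρ) t₀ := lt_min (lt_min hδ₂ hρ) ht₀.1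
      have hsub' : Ioo (t₀ - min (min δ₂ ρ) t₀) t₀ ⊆ Ioo 0 t₀ := Ioo_subset_Ioo_left (by linarith)
      obtain ⟨s, hsI, hcs, hδs, hEs, hus, hGs, hψs⟩ :=
        exists_of_ae_Ioo (by linarith : t₀ - min (min δ₂ ρ) t₀ < t₀) (ae_restrict_of_ae_restrict_of_subset hsub' hall)
      have hs2 : t₀ - s < δ₂ := by linarith [hsI.1]
      have hsρ : dist s t₀ < ρ := by
        rw [Real.dist_eq, abs_sub_comm, abs_of_pos (by linarith [hsI.2])]
        linarith [hsI.1]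
      have hsT : s ∈ Ioo 0 T := hsub (hsub' hsI)
      have hGκ : dist (G s) (G t₀) < κ := hρG hsT hsρ
      have hg2 : MemLp (fun x => ψ (t₀ - s) x - φ x) 2 volume := hψs.sub hφ2
      have hsplit : ∫ x, ⟪u s x, ψ (t₀ - s) x⟫_ℝ =
          (∫ x, ⟪u s x, φ x⟫_ℝ) + ∫ x, ⟪ψ (t₀ - s) x - φ x, u s x⟫_ℝ := by
        rw [← integral_add (integrable_inner₂ hus hφ2) (integrable_inner₂ hg2 hus)]
        refine integral_congr_ae (ae_of_all _ fun x => ?_)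
        show ⟪u s x, ψ (t₀ - s) x⟫_ℝ = ⟪u s x, φ x⟫_ℝ + ⟪ψ (t₀ - s) x - φ x, u s x⟫_ℝ
        rw [real_inner_comm (u s x) (ψ (t₀ - s) x - φ x), inner_sub_right]; ring
      have hsmall := abs_integral_inner_le_of_small hg2 hus hκ hEF0 (hδs hs2) hEs
      have e1 : c - G s = ∫ x, ⟪ψ (t₀ - s) x - φ x, u s x⟫_ℝ := by rw [← hcs, hsplit, hGs]; ring
      rw [Real.dist_eq] at hGκ
      calc |G t₀ - c| ≤ |G t₀ - G s| + |G s - c| := abs_sub_le _ _ _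
        _ ≤ κ + κ := by
            refine add_le_add ?_ ?_
            · rw [abs_sub_comm]; exact hGκ.le
            · rw [abs_sub_comm, e1]; exact hsmall
        _ = 2 * κ := by ring
    by_contra hne
    have hpos : 0 < |G t₀ - c| := abs_pos.2 (sub_ne_zero.2 hne)
    have := key (|G t₀ - c| / 4) (by positivity)
    linarith
  rw [hG₀, hB']
  exact hA

/-- `SlowModeBound` from D1 alone. -/
theorem slowModeBound_of_pairingConst (h1 : PairingConst) : SlowModeBound :=
  slowModeBound_core (dualityBound_core h1)

/-- **Net result: the v21 registered stub `stub_cellEnergyT` — statement verbatim — from D1 `PairingConst` alone.** -/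
theorem cellEnergyT_of_pairingConst (h1 : PairingConst) :
    ∀ k (W : Literature.Analysis.FluidPDE.LatticeShear.LatticeWord k) (M : ℝ) (hM : 0 < M) (c : ℝ), 0 < c →
    ∀ lo hi Λ β : ℝ, 0 < lo → lo ≤ 1 → 1 ≤ hi → 1 < Λ → 0 ≤ β →
      ∃ C : ℝ, 0 ≤ C ∧ ∃ ν₀ > (0:ℝ), ∃ K > (0:ℝ), CellEnergyClausesNoE W M hM c lo hi Λ β C ν₀ K :=
  cellEnergyT_of_slowModeBound (slowModeBound_of_pairingConst h1)

/-! ## §8 (v6) The uniform clauses discharge the window-local re-cut (F_T) a fortiori — the K1L_D registry-v2 text of `stub_cellEnergyT`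

Tenure D24-5 (14:06Z) re-typed `stub_cellEnergyT` to the window-local conclusion `CellEnergyClausesWNoE` (clause (F_T): the same bound
times `exp (C·(L²/(n²ν))·t)`), closed by the lead's primal `cellEnergyT_W`.  The uniform clauses imply it (`exp ≥ 1`), so the duality line
gives the v2 text too, from D1 alone. -/

/-- (F) ⇒ (F_T) without the energy conjunct: `CellEnergyClausesNoE → CellEnergyClausesWNoE` for `c, C ≥ 0` (`exp ≥ 1` on `t > 0`). [folklore] -/
theorem cellEnergyClausesWNoE_of_noE {k : ℕ} {W : Literature.Analysis.FluidPDE.LatticeShear.LatticeWord k} {M : ℝ} {hM : 0 < M}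
    {c : ℝ} {lo hi Λ β C ν₀ K : ℝ} (hc : 0 ≤ c) (hC : 0 ≤ C) (h : CellEnergyClausesNoE W M hM c lo hi Λ β C ν₀ K) :
    CellEnergyClausesWNoE W M hM c lo hi Λ β C ν₀ K := by
  intro ν hν n 𝔸 hodd hwin
  obtain ⟨hF, hCc⟩ := h ν hν n 𝔸 hodd hwin
  refine ⟨fun L hL hLn F hFd hmodes T hT u hu => ?_, hCc⟩
  filter_upwards [hF L hL hLn F hFd hmodes T hT u hu, ae_restrict_mem measurableSet_Ioo] with t ht htI
  refine ht.trans ?_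
  have hν0 : 0 < ν := hν.1
  have ht0 : 0 < t := htI.1
  have hA : 0 ≤ C * (c * L ^ 2 / ((n:ℝ) ^ 2 * ν ^ 2)) := by positivity
  have hB : 0 ≤ ∫ x, ‖F x‖ ^ 2 := integral_nonneg fun _ => by positivity
  have hE : 1 ≤ Real.exp (C * (L ^ 2 / ((n:ℝ) ^ 2 * ν)) * t) := Real.one_le_exp (by positivity)
  calc C * (c * L ^ 2 / ((n:ℝ) ^ 2 * ν ^ 2)) * ∫ x, ‖F x‖ ^ 2
      = C * (c * L ^ 2 / ((n:ℝ) ^ 2 * ν ^ 2)) * 1 * ∫ x, ‖F x‖ ^ 2 := by ring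
    _ ≤ C * (c * L ^ 2 / ((n:ℝ) ^ 2 * ν ^ 2)) * Real.exp (C * (L ^ 2 / ((n:ℝ) ^ 2 * ν)) * t) * ∫ x, ‖F x‖ ^ 2 := by
        gcongr

/-- **The K1L_D registry-v2 text of `stub_cellEnergyT` (conclusion `CellEnergyClausesWNoE`) from D1 alone**, a fortiori. [this file] -/
theorem cellEnergyT_W_of_pairingConst (h1 : PairingConst) :
    ∀ k (W : Literature.Analysis.FluidPDE.LatticeShear.LatticeWord k) (M : ℝ) (hM : 0 < M) (c : ℝ), 0 < c →
    ∀ lo hi Λ β : ℝ, 0 < lo → lo ≤ 1 → 1 ≤ hi → 1 < Λ → 0 ≤ β →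
      ∃ C : ℝ, 0 ≤ C ∧ ∃ ν₀ > (0:ℝ), ∃ K > (0:ℝ), CellEnergyClausesWNoE W M hM c lo hi Λ β C ν₀ K := by
  intro k W M hM c hc lo hi Λ β hlo hlo1 hhi hΛ hβ
  obtain ⟨C, hC, ν₀, hν₀, K, hK, h⟩ := cellEnergyT_of_pairingConst h1 k W M hM c hc lo hi Λ β hlo hlo1 hhi hΛ hβ
  exact ⟨C, hC, ν₀, hν₀, K, hK, cellEnergyClausesWNoE_of_noE hc.le hC h⟩

/-! ## §9 Discharge of D1 from the tree (ad-lit g25, p640160) — everything above becomes unconditional -/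

/-- **D1 holds**: the duality pairing of a weak solution and an adjoint weak solution is a.e. constant —
`Literature.Analysis.FluidPDE.Torus.IsWeakTensorPassiveVectorOn.exists_ae_integral_inner_reversed_eq_const` (the `L^∞` hypothesis on the
reversed carrier is derived there, so the corresponding binder of `PairingConst` is unused). [cite: Evans2010, §7.1.2-7.1.3] -/
theorem pairingConst : PairingConst := fun _ _ _ _ hN hlo _ hb _ _ hF2 hFdiv hu _ ht₀ _ _ hφ2 hφdiv _ hψ =>
  hu.exists_ae_integral_inner_reversed_eq_const ht₀.1 ht₀.2 hψ hN hlo hF2 hFdiv hφ2 hφdiv hb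

/-- `DualityBound`, unconditionally. [folklore] -/
theorem dualityBound : DualityBound := dualityBound_core pairingConst

/-- `SlowModeBound`, unconditionally. [folklore] -/
theorem slowModeBound : SlowModeBound := slowModeBound_of_pairingConst pairingConst

/-- `UniformSlowLeak` — clause (F) UNIFORMLY IN `T` with constant `36k²Λ²/(π⁴lo²c)` — unconditionally. [folklore] -/
theorem uniformSlowLeak : UniformSlowLeak := uniformSlowLeak_of_slowModeBound slowModeBound

/-- **The uniform cell-energy clauses for every design** (the v21 `stub_cellEnergyT` text, now a theorem): for every word `W`, pre-stretch `M`,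
gain constant `c > 0` and window `(lo, hi, Λ, β)` there are `C ≥ 0`, `ν₀ > 0`, `K > 0` with `CellEnergyClausesNoE W M hM c lo hi Λ β C ν₀ K`
(`C = 36k²Λ²/(π⁴lo²c)`, `ν₀ = 1`, `K = 2`). [folklore] -/
theorem cellEnergyT_uniform :
    ∀ k (W : Literature.Analysis.FluidPDE.LatticeShear.LatticeWord k) (M : ℝ) (hM : 0 < M) (c : ℝ), 0 < c →
    ∀ lo hi Λ β : ℝ, 0 < lo → lo ≤ 1 → 1 ≤ hi → 1 < Λ → 0 ≤ β →
      ∃ C : ℝ, 0 ≤ C ∧ ∃ ν₀ > (0:ℝ), ∃ K > (0:ℝ), CellEnergyClausesNoE W M hM c lo hi Λ β C ν₀ K :=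
  cellEnergyT_of_pairingConst pairingConst

/- The registry-v2 text (`CellEnergyClausesWNoE`, window-local) is ALREADY the tree theorem `…LagrangianStep.stub_cellEnergyT` (lead's primal
closer p640158); from the uniform clause it also follows a fortiori as `cellEnergyT_W_of_pairingConst pairingConst` — not restated here (dedup). -/

end Summit.AnomalousDissipation.AnomalousDissipation.Theorems.SolenoidalFractalHomogenisation.LagrangianStep.CellEnergyT

end
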